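import Summits.CriticalPhenomena.SAWScalingLimit.Theorems.SAWWeldingIdentificationWeldingSetupSign

/-!
# Welding configurations, I: uniqueness of the banks, three-point normalisation, existence
# (route `SAWWeldingIdentification`, helper for item `WeldingSetup`, stmt-CriticalPhenomena-4504)

For a conformal rectangle `Q = (Ω; a, c_L, b, c_R)` and a simple chord `γ` of `(Ω; a, b)`:

* `banks_unique` — the bank pair `(L, R)` of the route's clause is unique;
* `hasBoundaryValue_smul_trans`, `boundaryExtension_smul_trans` — boundary values of dilated
  uniformisers;
* `exists_chordal_hasBoundaryValue_sign` — three-point normalisation: a bank `(D; a, b)` has a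
  chordal uniformiser taking a prescribed third boundary point at `+1` or at `-1`;
* `exists_weldingData` — PART (i) of item `WeldingSetup` for ONE sign `σ = ±1` read off a
  reference uniformiser of `Ω` (so the same `σ` serves every chord): banks and normalised
  uniformisers `φ : (ℍ; 0, ∞, σ) → (L; a, b, c_L)`, `ψ : (ℍ; 0, ∞, -σ) → (R; a, b, c_R)`.

References: Ch. Pommerenke, *Boundary Behaviour of Conformal Maps* (1992), Thm. 2.6, Cor. 2.7.
-/

noncomputable section

namespace Summit.CriticalPhenomena.SAWScalingLimit.Theorems

open Set Filter Topology Complex Metric Function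
open UpperHalfPlane (upperHalfPlaneSet)
open Literature.Probability.RandomPlanarGeometry Literature.Topology.PlaneTopology

variable {Q : ConformalRectangle} {γ : CurveClass ℂ}

/-! ### Uniqueness of the banks -/

/-- **The bank pair is unique**: two pairs `(L, R)`, `(L', R')` satisfying the route's bank
clause coincide (each of `L`, `L'` is the inside of the same Jordan curve `γ ∪ arc(a, c_L, b)`).
[folklore] -/
theorem banks_unique (hγ : (Q.chord 0 2 (by decide)).IsSimpleChord γ) {L R L' R' : Set ℂ}
    (h : L ∪ R = Q.carrier \ γ.range ∧ Disjoint L R ∧ IsOpen L ∧ IsOpen R ∧ IsConnected L ∧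
      IsConnected R ∧ Q.pt 1 ∈ closure L ∧ Q.pt 3 ∈ closure R)
    (h' : L' ∪ R' = Q.carrier \ γ.range ∧ Disjoint L' R' ∧ IsOpen L' ∧ IsOpen R' ∧ IsConnected L' ∧
      IsConnected R' ∧ Q.pt 1 ∈ closure L' ∧ Q.pt 3 ∈ closure R') :
    L = L' ∧ R = R' := by
  obtain ⟨p, hp, hpinj, hprange, hp0, hp1⟩ := exists_param_of_isSimpleChord hγ
  obtain ⟨DL, hDL, -, -, -⟩ := exists_leftBank_dobrushinDomain hγ h hp hpinj hprange hp0 hp1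
  obtain ⟨DR, hDR, -, -, -⟩ := exists_rightBank_dobrushinDomain hγ h hp hpinj hprange hp0 hp1
  have hfr := frontier_banks_eq hγ h
  have hfr' := frontier_banks_eq hγ h'
  refine ⟨?_, ?_⟩
  · rw [← hDL]
    refine (JordanDomain.carrier_eq_of_frontier_eq' DL.toJordanDomain h'.2.2.1
      (Q.isBounded.subset (left_subset_carrier h')) h'.2.2.2.2.1 ?_).symm
    show frontier L' = frontier DL.carrier
    rw [hDL, hfr'.1, hfr.1]
  · rw [← hDR]
    refine (JordanDomain.carrier_eq_of_frontier_eq' DR.toJordanDomain h'.2.2.2.1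
      (Q.isBounded.subset (right_subset_carrier h')) h'.2.2.2.2.2.1 ?_).symm
    show frontier R' = frontier DR.carrier
    rw [hDR, hfr'.2, hfr.2]

/-! ### Dilations and boundary values -/

/-- Boundary values of a dilated uniformiser: if `φ → p` at the real point `c x` then
`z ↦ φ (c z)` tends to `p` at `x`. [folklore] -/
theorem hasBoundaryValue_smul_trans {U : Set ℂ} (φ : ConformalEquiv upperHalfPlaneSet U)
    {c : ℝ} (hc : 0 < c) {x : ℝ} {p : ℂ} (h : φ.HasBoundaryValue ((c * x : ℝ) : ℂ) p) :
    ((ConformalEquiv.smulUpperHalfPlane c hc).trans φ).HasBoundaryValue x p := by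
  have hmaps : MapsTo (fun z : ℂ => c • z) upperHalfPlaneSet upperHalfPlaneSet :=
    (ConformalEquiv.smulUpperHalfPlane c hc).mapsTo
  have hcont : Continuous fun z : ℂ => c • z := continuous_const_smul c
  have h1 : Tendsto (fun z : ℂ => c • z) (𝓝[upperHalfPlaneSet] (x : ℂ))
      (𝓝[upperHalfPlaneSet] ((c * x : ℝ) : ℂ)) := by
    have := (hcont.continuousWithinAt (s := upperHalfPlaneSet) (x := (x : ℂ))).tendsto_nhdsWithin hmaps
    have e : c • (x : ℂ) = ((c * x : ℝ) : ℂ) := by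
      rw [real_smul, ofReal_mul]
    rwa [e] at this
  exact h.comp h1

/-- The boundary extension of a dilated uniformiser of a Jordan domain:
`(φ ∘ (c ·))̄ x = φ̄ (c x)` at real points. [folklore] -/
theorem boundaryExtension_smul_trans {D : DobrushinDomain}
    (φ : ConformalEquiv upperHalfPlaneSet D.carrier) {c : ℝ} (hc : 0 < c) (x : ℝ) :
    ((ConformalEquiv.smulUpperHalfPlane c hc).trans φ).boundaryExtension x =
      φ.boundaryExtension ((c * x : ℝ) : ℂ) :=
  JordanDomain.boundaryExtension_eq_of_hasBoundaryValue' _ (by simp)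
    (hasBoundaryValue_smul_trans φ hc (tendsto_boundaryExtension_ofReal φ (c * x)))

/-- **Three-point normalisation of a bank.** A Dobrushin domain `(D; a, b)` with a third
boundary point `c ≠ a, b` admits a chordal uniformiser `φ : (ℍ; 0, ∞) → (D; a, b)` taking the
value `c` at `s = 1` or at `s = -1` (dilate any chordal uniformiser; which sign occurs is a matter
of orientation). Pommerenke (1992), Cor. 2.7. [folklore] -/
theorem exists_chordal_hasBoundaryValue_sign (D : DobrushinDomain) {c : ℂ}
    (hc : c ∈ frontier D.carrier) (hca : c ≠ D.pt 0) (hcb : c ≠ D.pt 1) :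
    ∃ (φ : ConformalEquiv upperHalfPlaneSet D.carrier) (s : ℝ), (s = 1 ∨ s = -1) ∧
      D.IsChordalUniformizing φ ∧ φ.HasBoundaryValue s c := by
  obtain ⟨φ₀, hφ₀⟩ := MarkedDomain.exists_isChordalUniformizing_holds D
  obtain ⟨t₀, ht₀, h⟩ := exists_ne_zero_boundaryExtension_eq φ₀ hφ₀ hc hca hcb
  have hl : 0 < |t₀| := abs_pos.2 ht₀
  set s : ℝ := if 0 < t₀ then 1 else -1 with hs
  have hsval : s = 1 ∨ s = -1 := by
    by_cases h0 : 0 < t₀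
    · exact Or.inl (if_pos h0)
    · exact Or.inr (if_neg h0)
  have hmul : |t₀| * s = t₀ := by
    by_cases h0 : 0 < t₀
    · rw [show s = 1 from if_pos h0, mul_one, abs_of_pos h0]
    · rw [show s = -1 from if_neg h0, mul_neg_one, abs_of_neg (lt_of_le_of_ne (not_lt.1 h0) ht₀),
        neg_neg]
  refine ⟨(ConformalEquiv.smulUpperHalfPlane |t₀| hl).trans φ₀, s, hsval, hφ₀.smul_trans _ hl, ?_⟩
  refine hasBoundaryValue_smul_trans φ₀ hl ?_
  rw [hmul, ← h]
  exact tendsto_boundaryExtension_ofReal φ₀ t₀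

/-! ### Part (i): banks and normalised uniformisers with the reference sign -/

/-- **Part (i) of `WeldingSetup`, for the reference sign.** Let `Φ : (ℍ; 0, ∞) → (Ω; a, b)` be a
chordal uniformiser of `Q.chord 0 2` with `Φ(t_L) = c_L`, and let `σ = 1` if `t_L > 0`, `σ = -1`
if `t_L < 0`. Then every simple chord `γ` of `(Ω; a, b)` has banks `L`, `R` (Newman) and
normalised uniformisers `φ : (ℍ; 0, ∞, σ) → (L; a, b, c_L)`, `ψ : (ℍ; 0, ∞, -σ) → (R; a, b, c_R)`
(Riemann mapping + Carathéodory + three-point normalisation, the sign being forced by the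
orientation rule). [folklore] -/
theorem exists_weldingData (hγ : (Q.chord 0 2 (by decide)).IsSimpleChord γ)
    (Φ : ConformalEquiv upperHalfPlaneSet (Q.chord 0 2 (by decide)).carrier)
    (hΦ : (Q.chord 0 2 (by decide)).IsChordalUniformizing Φ) {tL : ℝ}
    (htL : Φ.boundaryExtension tL = Q.pt 1) {σ : ℝ} (hσ : (0 < tL ∧ σ = 1) ∨ (tL < 0 ∧ σ = -1)) :
    ∃ (L R : Set ℂ) (φ : ConformalEquiv upperHalfPlaneSet L)
      (ψ : ConformalEquiv upperHalfPlaneSet R),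
      (L ∪ R = Q.carrier \ γ.range ∧ Disjoint L R ∧ IsOpen L ∧ IsOpen R ∧ IsConnected L ∧
        IsConnected R ∧ Q.pt 1 ∈ closure L ∧ Q.pt 3 ∈ closure R) ∧
      (φ.HasBoundaryValue 0 (Q.pt 0) ∧ φ.HasBoundaryValueAtInfty (Q.pt 2) ∧
        φ.HasBoundaryValue ((σ : ℝ) : ℂ) (Q.pt 1) ∧ ψ.HasBoundaryValue 0 (Q.pt 0) ∧
        ψ.HasBoundaryValueAtInfty (Q.pt 2) ∧ ψ.HasBoundaryValue (-((σ : ℝ) : ℂ)) (Q.pt 3)) := by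
  obtain ⟨U₁, U₂, hU₁o, hU₂o, hU₁c, hU₂c, hdisj, hU, hf₁, hf₂⟩ := exists_banks hγ
  have h1 : Q.pt 1 ∈ closure U₁ := by
    rw [closure_eq_self_union_frontier, hf₁, image_Icc_left_eq]
    exact Or.inr (Or.inr (Or.inl (pt_one_mem_arc Q)))
  have h3 : Q.pt 3 ∈ closure U₂ := by
    rw [closure_eq_self_union_frontier, hf₂, image_Icc_right_eq]
    exact Or.inr (Or.inr (Or.inl (pt_three_mem_arc Q)))
  have hb : U₁ ∪ U₂ = Q.carrier \ γ.range ∧ Disjoint U₁ U₂ ∧ IsOpen U₁ ∧ IsOpen U₂ ∧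
      IsConnected U₁ ∧ IsConnected U₂ ∧ Q.pt 1 ∈ closure U₁ ∧ Q.pt 3 ∈ closure U₂ :=
    ⟨hU, hdisj, hU₁o, hU₂o, hU₁c, hU₂c, h1, h3⟩
  obtain ⟨p, hp, hpinj, hprange, hp0, hp1⟩ := exists_param_of_isSimpleChord hγ
  obtain ⟨DL, hDL, hLa, hLb, -⟩ := exists_leftBank_dobrushinDomain hγ hb hp hpinj hprange hp0 hp1
  obtain ⟨DR, hDR, hRa, hRb, -⟩ := exists_rightBank_dobrushinDomain hγ hb hp hpinj hprange hp0 hp1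
  subst hDL hDR
  -- the normalised uniformisers
  have hcL : Q.pt 1 ∈ frontier DL.carrier := by
    rw [hf₁, image_Icc_left_eq]; exact Or.inr (Or.inl (pt_one_mem_arc Q))
  have hcR : Q.pt 3 ∈ frontier DR.carrier := by
    rw [hf₂, image_Icc_right_eq]; exact Or.inr (Or.inl (pt_three_mem_arc Q))
  obtain ⟨φ, s, hs, hφ, hφs⟩ := exists_chordal_hasBoundaryValue_sign DL hcL
    (by rw [hLa]; exact fun h => absurd (Q.pt_injective h) (by decide))
    (by rw [hLb]; exact fun h => absurd (Q.pt_injective h) (by decide))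
  obtain ⟨ψ, s', hs', hψ, hψs⟩ := exists_chordal_hasBoundaryValue_sign DR hcR
    (by rw [hRa]; exact fun h => absurd (Q.pt_injective h) (by decide))
    (by rw [hRb]; exact fun h => absurd (Q.pt_injective h) (by decide))
  have hφ0 : φ.HasBoundaryValue 0 (Q.pt 0) := hLa ▸ hφ.1
  have hφi : φ.HasBoundaryValueAtInfty (Q.pt 2) := hLb ▸ hφ.2
  have hψ0 : ψ.HasBoundaryValue 0 (Q.pt 0) := hRa ▸ hψ.1
  have hψi : ψ.HasBoundaryValueAtInfty (Q.pt 2) := hRb ▸ hψ.2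
  -- the signs are forced
  have hsσ : s = σ := by
    rcases hσ with ⟨ht, rfl⟩ | ⟨ht, rfl⟩
    · have := sign_left_pos hγ Φ hΦ htL hb φ hφ0 hφi ht hφs
      rcases hs with rfl | rfl
      · rfl
      · linarith
    · have := sign_left_neg hγ Φ hΦ htL hb φ hφ0 hφi ht hφs
      rcases hs with rfl | rfl
      · linarith
      · rfl
  have hs'σ : s' = -σ := by
    rcases hσ with ⟨ht, rfl⟩ | ⟨ht, rfl⟩
    · have := sign_right_pos hγ Φ hΦ htL hb ψ hψ0 hψi ht hψs
      rcases hs' with rfl | rfl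
      · linarith
      · rfl
    · have := sign_right_neg hγ Φ hΦ htL hb ψ hψ0 hψi ht hψs
      rcases hs' with rfl | rfl
      · norm_num
      · linarith
  subst hsσ
  refine ⟨DL.carrier, DR.carrier, φ, ψ, hb, hφ0, hφi, hφs, hψ0, hψi, ?_⟩
  rw [← ofReal_neg, ← hs'σ]
  exact hψs

end Summit.CriticalPhenomena.SAWScalingLimit.Theorems
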